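import Literature.Geometry.Kaehler.HolomorphicChainNormalChart
import Literature.Analysis.Complex.OsgoodProofs
import Mathlib.Analysis.Calculus.InverseFunctionTheorem.ContDiff

/-!
# Orthogonally normalised holomorphic charts at the regular points of a holomorphic chain

The normalised chart `Ψ₀` of `HolomorphicChainNormalChart.lean` at a carrier point `b` of a
holomorphic `p`-chain `T` is a holomorphic graph over its tangent plane `K` with respect to SOME
linear projection `π₁ : V → K`. Here it is reparametrised, by the inverse function theorem applied
to `φ(k) = P_K(Ψ₀ k − b)` (`P_K` the orthogonal projection onto `K`, `Dφ(0) = id`), into a chart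
`Ψ = Ψ₀ ∘ φ⁻¹` which is a graph over `K` with respect to the **orthogonal** projection:

`HolomorphicChain.exists_orthoChart` — a complex `p`-plane `K`, `ρ > 0`, an open `N ∋ b` and
`Ψ : K → V` holomorphic on `ball 0 ρ` with `Ψ 0 = b`, `DΨ(0) = ι_K`, **`P_K(Ψ k − b) = k`**,
`Ψ(ball 0 ρ) ⊆ reg |T|` and `reg |T| ∩ N ⊆ Ψ(ball 0 ρ)`.

Since `‖P_K‖ ≤ 1`, such charts are almost isometric near `0` (`‖k‖ ≤ ‖Ψ k − b‖`), which is what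
the covering arguments of King's tangent cone theorem require.

Theorems only; no named facts.

## References

* E. M. Chirka, *Complex Analytic Sets*, Kluwer 1989, §2.3 [Chirka1989].
* H. Federer, *Geometric Measure Theory*, Springer 1969, 3.1.19, 4.3.18 [Federer1969].
-/

noncomputable section

open scoped Manifold Topology ENNReal
open Set Filter Metric Function Module TopologicalSpace MeasureTheory

namespace Literature.Geometry.Kaehler

namespace HolomorphicChain

open Literature.Geometry.GeometricMeasureTheory

universe u

variable {V : Type u} [NormedAddCommGroup V] [InnerProductSpace ℂ V] [FiniteDimensional ℂ V]
  [MeasurableSpace V] [BorelSpace V] {Ω : Opens V} {p : ℕ}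

/-- **Orthogonally normalised holomorphic chart at a point of the carrier.** See the module
docstring. [cite: Chirka1989, §2.3; Federer1969, 3.1.19] -/
theorem exists_orthoChart (T : HolomorphicChain 𝓘(ℂ, V) Ω p) {b : V} (hb : b ∈ T.carrier) :
    ∃ (K : Submodule ℂ V) (ρ : ℝ) (Ψ : K → V) (N : Set V),
      finrank ℂ K = p ∧ 0 < ρ ∧ IsOpen N ∧ b ∈ N ∧ N ⊆ (Ω : Set V) ∧
      DifferentiableOn ℂ Ψ (ball 0 ρ) ∧ Ψ 0 = b ∧ fderiv ℂ Ψ 0 = K.subtypeL ∧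
      (∀ k ∈ ball (0 : K) ρ, K.orthogonalProjectionOnto (Ψ k - b) = k) ∧
      (∀ k ∈ ball (0 : K) ρ, Ψ k ∈ T.carrier) ∧
      T.carrier ∩ N ⊆ Ψ '' ball 0 ρ := by
  obtain ⟨K, π₁, ρ₀, Ψ₀, N₀, hKp, hπ₁, hρ₀, hN₀o, hbN₀, hN₀Ω, hΨ₀d, hΨ₀0, hDΨ₀, hπΨ₀, hΨ₀c, hcN₀,
    -, -⟩ := T.exists_normalChart hb
  set P : V →L[ℂ] K := K.orthogonalProjectionOnto with hPdef
  -- `φ(k) = P(Ψ₀ k - b)`, with `Dφ(0) = id`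
  set φ : K → K := fun k => P (Ψ₀ k - b) with hφdef
  have hΨ₀an : AnalyticAt ℂ Ψ₀ 0 :=
    Literature.Analysis.Complex.SCV.analyticOnNhd_of_differentiableOn hΨ₀d isOpen_ball 0
      (mem_ball_self hρ₀)
  have hΨ₀cd : ContDiffAt ℂ 1 Ψ₀ 0 := hΨ₀an.contDiffAt.of_le le_top
  have hΨ₀s : HasStrictFDerivAt Ψ₀ (K.subtypeL : K →L[ℂ] V) 0 := by
    have := hΨ₀cd.hasStrictFDerivAt one_ne_zero
    rwa [hDΨ₀] at this
  have hφs : HasStrictFDerivAt φ ((ContinuousLinearEquiv.refl ℂ K : K ≃L[ℂ] K) : K →L[ℂ] K) 0 := by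
    have h1 : HasStrictFDerivAt (fun k => Ψ₀ k - b) (K.subtypeL : K →L[ℂ] V) 0 := hΨ₀s.sub_const b
    have h2 := P.hasStrictFDerivAt.comp (0 : K) h1
    have hPι : P.comp K.subtypeL = ((ContinuousLinearEquiv.refl ℂ K : K ≃L[ℂ] K) : K →L[ℂ] K) := by
      ext k
      simp [hPdef]
    rw [hPι] at h2
    exact h2
  have hφcd : ContDiffAt ℂ 1 φ 0 := by
    have : ContDiffAt ℂ 1 (fun k => Ψ₀ k - b) 0 := hΨ₀cd.sub contDiffAt_const
    exact P.contDiff.contDiffAt.comp 0 this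
  have hφ0 : φ 0 = 0 := by simp [hφdef, hΨ₀0]
  have hφ' : HasFDerivAt φ ((ContinuousLinearEquiv.refl ℂ K : K ≃L[ℂ] K) : K →L[ℂ] K) 0 :=
    hφs.hasFDerivAt
  -- the local inverse `χ` of `φ` at `0`
  set χ : K → K := hφcd.localInverse hφ' one_ne_zero with hχdef
  have hχ0 : χ 0 = 0 := by
    have := hφcd.localInverse_apply_image hφ' one_ne_zero
    rwa [hφ0] at this
  have hχcd : ContDiffAt ℂ 1 χ 0 := by
    have := hφcd.to_localInverse hφ' one_ne_zero
    rwa [hφ0] at this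
  have hright : ∀ᶠ k in 𝓝 (0 : K), φ (χ k) = k := by
    have := hφs.eventually_right_inverse
    rwa [hφ0] at this
  have hχs : HasStrictFDerivAt χ ((ContinuousLinearEquiv.refl ℂ K).symm : K →L[ℂ] K) 0 := by
    have := hφs.to_localInverse
    rwa [hφ0] at this
  have hχcont : ContinuousAt χ 0 := hχcd.continuousAt
  -- differentiability of `χ` near `0`
  have hχdiff : ∀ᶠ k in 𝓝 (0 : K), DifferentiableAt ℂ χ k := by
    filter_upwards [hχcd.eventually (by simp)] with k hk
    exact hk.differentiableAt one_ne_zero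
  -- `χ` maps a small ball into `ball 0 ρ₀`
  have hχball : ∀ᶠ k in 𝓝 (0 : K), χ k ∈ ball (0 : K) ρ₀ := by
    have : Tendsto χ (𝓝 0) (𝓝 (χ 0)) := hχcont
    rw [hχ0] at this
    exact this (ball_mem_nhds 0 hρ₀)
  obtain ⟨ρ, hρ, hρall⟩ : ∃ ρ > 0, ∀ k ∈ ball (0 : K) ρ,
      φ (χ k) = k ∧ DifferentiableAt ℂ χ k ∧ χ k ∈ ball (0 : K) ρ₀ := by
    have := (hright.and hχdiff).and hχball
    obtain ⟨ρ, hρ, h⟩ := Metric.eventually_nhds_iff_ball.1 this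
    exact ⟨ρ, hρ, fun k hk => ⟨(h k hk).1.1, (h k hk).1.2, (h k hk).2⟩⟩
  -- the chart `Ψ = Ψ₀ ∘ χ`
  set Ψ : K → V := Ψ₀ ∘ χ with hΨdef
  have hΨd : DifferentiableOn ℂ Ψ (ball 0 ρ) := fun k hk =>
    ((hΨ₀d _ (hρall k hk).2.2).differentiableAt (isOpen_ball.mem_nhds (hρall k hk).2.2)).comp k
      (hρall k hk).2.1 |>.differentiableWithinAt
  have hΨ0 : Ψ 0 = b := by simp [hΨdef, hχ0, hΨ₀0]
  have hDΨ : fderiv ℂ Ψ 0 = K.subtypeL := by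
    have h1 : HasFDerivAt χ ((ContinuousLinearEquiv.refl ℂ K).symm : K →L[ℂ] K) 0 := hχs.hasFDerivAt
    have h2 : HasFDerivAt Ψ₀ (K.subtypeL : K →L[ℂ] V) (χ 0) := by rw [hχ0]; exact hΨ₀s.hasFDerivAt
    have := h2.comp (0 : K) h1
    rw [show (Ψ₀ ∘ χ) = Ψ from rfl] at this
    rw [this.fderiv]
    ext k
    simp
  have hPΨ : ∀ k ∈ ball (0 : K) ρ, P (Ψ k - b) = k := fun k hk => (hρall k hk).1
  -- a neighbourhood `N` of `b` whose carrier points come from `Ψ (ball 0 ρ)`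
  -- (points `x = Ψ₀ k₀` with `k₀ = π₁ (x - b)` small and `P (x - b) ∈ ball 0 ρ`)
  have hsource : ∀ᶠ k₀ in 𝓝 (0 : K), χ (φ k₀) = k₀ := by
    have := hφs.eventually_left_inverse
    exact this
  obtain ⟨s, hs, hsall⟩ : ∃ s > 0, ∀ k₀ ∈ ball (0 : K) s, χ (φ k₀) = k₀ :=
    let ⟨s, hs, h⟩ := Metric.eventually_nhds_iff_ball.1 hsource; ⟨s, hs, h⟩
  set r : ℝ := min ρ (s / (‖π₁‖ + 1)) with hrdef
  have hr : 0 < r := lt_min hρ (div_pos hs (by positivity))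
  refine ⟨K, ρ, Ψ, N₀ ∩ ball b r, hKp, hρ, hN₀o.inter isOpen_ball, ⟨hbN₀, mem_ball_self hr⟩,
    inter_subset_left.trans hN₀Ω, hΨd, hΨ0, hDΨ, hPΨ,
    fun k hk => hΨ₀c _ (hρall k hk).2.2, ?_⟩
  rintro x ⟨hxc, hxN₀, hxb⟩
  obtain ⟨k₀, hk₀, rfl⟩ := hcN₀ ⟨hxc, hxN₀⟩
  -- `k₀ = π₁ (Ψ₀ k₀ - b)` is small
  have hk₀eq : π₁ (Ψ₀ k₀ - b) = k₀ := hπΨ₀ k₀ hk₀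
  rw [mem_ball, dist_eq_norm] at hxb
  have hk₀s : k₀ ∈ ball (0 : K) s := by
    rw [mem_ball, dist_zero_right, ← hk₀eq]
    calc ‖π₁ (Ψ₀ k₀ - b)‖ ≤ ‖π₁‖ * ‖Ψ₀ k₀ - b‖ := π₁.le_opNorm _
      _ ≤ (‖π₁‖ + 1) * ‖Ψ₀ k₀ - b‖ := by gcongr; linarith
      _ < (‖π₁‖ + 1) * (s / (‖π₁‖ + 1)) := by
          gcongr
          exact hxb.trans_le (min_le_right _ _)
      _ = s := by field_simp
  -- and `φ k₀ = P (x - b)` lies in `ball 0 ρ`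
  have hφk₀ : φ k₀ ∈ ball (0 : K) ρ := by
    rw [mem_ball, dist_zero_right, hφdef]
    calc ‖P (Ψ₀ k₀ - b)‖ ≤ ‖Ψ₀ k₀ - b‖ := K.norm_orthogonalProjectionOnto_apply_le _
      _ < r := hxb
      _ ≤ ρ := min_le_left _ _
  refine ⟨φ k₀, hφk₀, ?_⟩
  simp only [hΨdef, comp_apply, hsall k₀ hk₀s]

/-- **Orthogonally normalised chart, with tangent spaces and density** — the same chart as in
`exists_orthoChart`, together with: the approximate tangent space `Tan^{2p}(𝓗^{2p} ⌞ reg|T|, Ψ k)`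
equals `im DΨ(k)` on the ball, and the density `θ_T` is a.e. constant on `reg|T| ∩ N` (both
inherited from `exists_normalChart`, the reparametrisation being a local biholomorphism).
[cite: Chirka1989, §2.3; Federer1969, 3.1.19, 4.3.18] -/
theorem exists_orthoChart_tangent (T : HolomorphicChain 𝓘(ℂ, V) Ω p) {b : V} (hb : b ∈ T.carrier) :
    ∃ (K : Submodule ℂ V) (ρ : ℝ) (Ψ : K → V) (N : Set V),
      finrank ℂ K = p ∧ 0 < ρ ∧ IsOpen N ∧ b ∈ N ∧ N ⊆ (Ω : Set V) ∧
      DifferentiableOn ℂ Ψ (ball 0 ρ) ∧ Ψ 0 = b ∧ fderiv ℂ Ψ 0 = K.subtypeL ∧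
      (∀ k ∈ ball (0 : K) ρ, K.orthogonalProjectionOnto (Ψ k - b) = k) ∧
      (∀ k ∈ ball (0 : K) ρ, Ψ k ∈ T.carrier) ∧
      T.carrier ∩ N ⊆ Ψ '' ball 0 ρ ∧
      (∀ k ∈ ball (0 : K) ρ,
        approxTangentCone (2 * p) ((μHE[2 * p] : Measure V).restrict T.carrier) (Ψ k) =
          Set.range (fderiv ℂ Ψ k)) ∧
      ∃ k₀ : ℤ, ∀ᵐ y ∂((μHE[2 * p] : Measure V).restrict (T.carrier ∩ N)), T.density y = k₀ := by
  obtain ⟨K, π₁, ρ₀, Ψ₀, N₀, hKp, hπ₁, hρ₀, hN₀o, hbN₀, hN₀Ω, hΨ₀d, hΨ₀0, hDΨ₀, hπΨ₀, hΨ₀c, hcN₀,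
    htan₀, k₀, hdens₀⟩ := T.exists_normalChart hb
  set P : V →L[ℂ] K := K.orthogonalProjectionOnto with hPdef
  set φ : K → K := fun k => P (Ψ₀ k - b) with hφdef
  have hΨ₀an := Literature.Analysis.Complex.SCV.analyticOnNhd_of_differentiableOn hΨ₀d isOpen_ball
  have hΨ₀cd : ContDiffAt ℂ 1 Ψ₀ 0 := (hΨ₀an 0 (mem_ball_self hρ₀)).contDiffAt.of_le le_top
  have hΨ₀s : HasStrictFDerivAt Ψ₀ (K.subtypeL : K →L[ℂ] V) 0 := by
    have := hΨ₀cd.hasStrictFDerivAt one_ne_zero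
    rwa [hDΨ₀] at this
  have hPι : P.comp K.subtypeL = ((ContinuousLinearEquiv.refl ℂ K : K ≃L[ℂ] K) : K →L[ℂ] K) := by
    ext k; simp [hPdef]
  have hφs : HasStrictFDerivAt φ ((ContinuousLinearEquiv.refl ℂ K : K ≃L[ℂ] K) : K →L[ℂ] K) 0 := by
    have h2 := P.hasStrictFDerivAt.comp (0 : K) (hΨ₀s.sub_const b)
    rwa [hPι] at h2
  have hφcd : ContDiffAt ℂ 1 φ 0 := P.contDiff.contDiffAt.comp 0 (hΨ₀cd.sub contDiffAt_const)
  have hφ0 : φ 0 = 0 := by simp [hφdef, hΨ₀0]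
  have hφ' : HasFDerivAt φ ((ContinuousLinearEquiv.refl ℂ K : K ≃L[ℂ] K) : K →L[ℂ] K) 0 :=
    hφs.hasFDerivAt
  -- `φ` is differentiable on `ball 0 ρ₀`, with derivative `P ∘ DΨ₀`
  have hφd : ∀ k ∈ ball (0 : K) ρ₀, HasFDerivAt φ (P.comp (fderiv ℂ Ψ₀ k)) k := fun k hk =>
    P.hasFDerivAt.comp k (((hΨ₀d k hk).differentiableAt (isOpen_ball.mem_nhds hk)).hasFDerivAt.sub_const b)
  set χ : K → K := hφcd.localInverse hφ' one_ne_zero with hχdef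
  have hχ0 : χ 0 = 0 := by
    have := hφcd.localInverse_apply_image hφ' one_ne_zero
    rwa [hφ0] at this
  have hχcd : ContDiffAt ℂ 1 χ 0 := by
    have := hφcd.to_localInverse hφ' one_ne_zero
    rwa [hφ0] at this
  have hright : ∀ᶠ k in 𝓝 (0 : K), φ (χ k) = k := by
    have := hφs.eventually_right_inverse
    rwa [hφ0] at this
  have hχs : HasStrictFDerivAt χ ((ContinuousLinearEquiv.refl ℂ K).symm : K →L[ℂ] K) 0 := by
    have := hφs.to_localInverse
    rwa [hφ0] at this
  have hχdiff : ∀ᶠ k in 𝓝 (0 : K), DifferentiableAt ℂ χ k := by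
    filter_upwards [hχcd.eventually (by simp)] with k hk
    exact hk.differentiableAt one_ne_zero
  have hχball : ∀ᶠ k in 𝓝 (0 : K), χ k ∈ ball (0 : K) ρ₀ := by
    have : Tendsto χ (𝓝 0) (𝓝 (χ 0)) := hχcd.continuousAt
    rw [hχ0] at this
    exact this (ball_mem_nhds 0 hρ₀)
  obtain ⟨ρ, hρ, hρall⟩ : ∃ ρ > 0, ∀ k ∈ ball (0 : K) ρ,
      φ (χ k) = k ∧ DifferentiableAt ℂ χ k ∧ χ k ∈ ball (0 : K) ρ₀ := by
    obtain ⟨ρ, hρ, h⟩ := Metric.eventually_nhds_iff_ball.1 ((hright.and hχdiff).and hχball)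
    exact ⟨ρ, hρ, fun k hk => ⟨(h k hk).1.1, (h k hk).1.2, (h k hk).2⟩⟩
  set Ψ : K → V := Ψ₀ ∘ χ with hΨdef
  have hΨ₀at : ∀ k ∈ ball (0 : K) ρ, DifferentiableAt ℂ Ψ₀ (χ k) := fun k hk =>
    (hΨ₀d _ (hρall k hk).2.2).differentiableAt (isOpen_ball.mem_nhds (hρall k hk).2.2)
  have hΨd : DifferentiableOn ℂ Ψ (ball 0 ρ) := fun k hk =>
    ((hΨ₀at k hk).comp k (hρall k hk).2.1).differentiableWithinAt
  have hΨ0 : Ψ 0 = b := by simp [hΨdef, hχ0, hΨ₀0]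
  have hDΨ : fderiv ℂ Ψ 0 = K.subtypeL := by
    have h2 : HasFDerivAt Ψ₀ (K.subtypeL : K →L[ℂ] V) (χ 0) := by rw [hχ0]; exact hΨ₀s.hasFDerivAt
    have := h2.comp (0 : K) hχs.hasFDerivAt
    rw [show (Ψ₀ ∘ χ) = Ψ from rfl] at this
    rw [this.fderiv]; ext k; simp
  have hPΨ : ∀ k ∈ ball (0 : K) ρ, P (Ψ k - b) = k := fun k hk => (hρall k hk).1
  -- `Dχ(k)` is surjective: `Dφ(χ k) ∘ Dχ(k) = id`
  have hrange : ∀ k ∈ ball (0 : K) ρ, Set.range (fderiv ℂ Ψ k) = Set.range (fderiv ℂ Ψ₀ (χ k)) := by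
    intro k hk
    have hχk := (hρall k hk).2.1
    have hcomp : fderiv ℂ Ψ k = (fderiv ℂ Ψ₀ (χ k)).comp (fderiv ℂ χ k) :=
      fderiv_comp k (hΨ₀at k hk) hχk
    -- surjectivity of `Dχ k`
    have hid : (P.comp (fderiv ℂ Ψ₀ (χ k))).comp (fderiv ℂ χ k) = ContinuousLinearMap.id ℂ K := by
      have h1 : HasFDerivAt (φ ∘ χ) ((P.comp (fderiv ℂ Ψ₀ (χ k))).comp (fderiv ℂ χ k)) k :=
        (hφd _ (hρall k hk).2.2).comp k hχk.hasFDerivAt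
      have h2 : HasFDerivAt (φ ∘ χ) (ContinuousLinearMap.id ℂ K) k := by
        refine (hasFDerivAt_id k).congr_of_eventuallyEq ?_
        filter_upwards [isOpen_ball.mem_nhds hk] with k' hk' using (hρall k' hk').1
      exact h1.unique h2
    have hsurj : Function.Surjective (fderiv ℂ χ k) := by
      have hinj : Function.Injective (fderiv ℂ χ k) := fun a c hac => by
        have := congrArg ((P.comp (fderiv ℂ Ψ₀ (χ k))).comp (fderiv ℂ χ k)) (show a = a from rfl)
        have ha := congrArg (fun f : K →L[ℂ] K => f a) hid
        have hc := congrArg (fun f : K →L[ℂ] K => f c) hid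
        simp only [ContinuousLinearMap.comp_apply, ContinuousLinearMap.id_apply] at ha hc
        rw [← ha, ← hc, hac]
      exact LinearMap.surjective_of_injective (f := (fderiv ℂ χ k : K →ₗ[ℂ] K)) hinj
    rw [hcomp, ContinuousLinearMap.coe_comp, Set.range_comp, hsurj.range_eq, Set.image_univ]
  -- the neighbourhood `N`
  obtain ⟨s, hs, hsall⟩ : ∃ s > 0, ∀ k₀' ∈ ball (0 : K) s, χ (φ k₀') = k₀' :=
    let ⟨s, hs, h⟩ := Metric.eventually_nhds_iff_ball.1 hφs.eventually_left_inverse; ⟨s, hs, h⟩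
  set r : ℝ := min ρ (s / (‖π₁‖ + 1)) with hrdef
  have hr : 0 < r := lt_min hρ (div_pos hs (by positivity))
  refine ⟨K, ρ, Ψ, N₀ ∩ ball b r, hKp, hρ, hN₀o.inter isOpen_ball, ⟨hbN₀, mem_ball_self hr⟩,
    inter_subset_left.trans hN₀Ω, hΨd, hΨ0, hDΨ, hPΨ, fun k hk => hΨ₀c _ (hρall k hk).2.2, ?_,
    fun k hk => ?_, k₀, ?_⟩
  · rintro x ⟨hxc, hxN₀, hxb⟩
    obtain ⟨k₀', hk₀', rfl⟩ := hcN₀ ⟨hxc, hxN₀⟩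
    have hk₀eq : π₁ (Ψ₀ k₀' - b) = k₀' := hπΨ₀ k₀' hk₀'
    rw [mem_ball, dist_eq_norm] at hxb
    have hk₀s : k₀' ∈ ball (0 : K) s := by
      rw [mem_ball, dist_zero_right, ← hk₀eq]
      calc ‖π₁ (Ψ₀ k₀' - b)‖ ≤ ‖π₁‖ * ‖Ψ₀ k₀' - b‖ := π₁.le_opNorm _
        _ ≤ (‖π₁‖ + 1) * ‖Ψ₀ k₀' - b‖ := by gcongr; linarith
        _ < (‖π₁‖ + 1) * (s / (‖π₁‖ + 1)) := by
            gcongr; exact hxb.trans_le (min_le_right _ _)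
        _ = s := by field_simp
    have hφk₀ : φ k₀' ∈ ball (0 : K) ρ := by
      rw [mem_ball, dist_zero_right, hφdef]
      calc ‖P (Ψ₀ k₀' - b)‖ ≤ ‖Ψ₀ k₀' - b‖ := K.norm_orthogonalProjectionOnto_apply_le _
        _ < r := hxb
        _ ≤ ρ := min_le_left _ _
    exact ⟨φ k₀', hφk₀, by simp only [hΨdef, comp_apply, hsall k₀' hk₀s]⟩
  · rw [hrange k hk]
    exact htan₀ _ (hρall k hk).2.2
  · exact ae_mono (Measure.restrict_mono (inter_subset_inter_right _ inter_subset_left) le_rfl) hdens₀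

end HolomorphicChain

end Literature.Geometry.Kaehler
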